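import Summits.QuantumFields.QCD.Theses.HeatSlicedQuarks
import Summits.QuantumFields.QCD.Theses.GradientFlowSpecies
import Summits.QuantumFields.QCD.Theorems.GluonicCompletion.Negative.Threshold

/-!
# Line `existence-pays-the-continuum-half` — checked skeleton for the crux
`Summit.QuantumFields.QCD.Theses.HeatSlicedQuarks.RobustYangMillsHandover` (stmt-QuantumFields-8892)

Planner crux-plan, round 1.  Idea card `Cruxes/RobustYangMillsHandover/Ideas/existence-pays-the-continuum-half.md`
(ideator 1), triage `TRIAGE-r1-{1,2,3}.md` (3 × pass; sharpenings honoured below), standing disproof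
`Cruxes/RobustYangMillsHandover/Disproof.lean` (cycles 1–2, §§1–9; landed negatives
`Theorems/RobustYangMillsHandover/Negative/{WithoutNontriviality,GapClauses,SchemeAsymptotics}.lean`).
Line card: `Cruxes/RobustYangMillsHandover/Lines/existence-pays-the-continuum-half.md`.

## The crux and the line in one paragraph

The crux is the bare arrow `RobustYangMillsHandover := ContinuumQCDExists → QCD` (X₀ → QCD): given, for
`N_f = 2, 3`, ONE honest mass-independent regularisation `reg` (`HasMassScaling`; for every positive mass
tuple some species renormalisations `z, shift` and OS data `T` with `IsQCDAlong (reg.scheme m z shift) T`,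
non-trivial non-Gaussian glue, every flavour-changing pseudoscalar non-trivial), produce the two GAP clauses
of `QCDOf` (`T.HasMassGap Δ` and `(reg.scheme m z shift).HasLatticeMassGap Δ`).  THE LEVER (card): keep X₀'s
OWN regularisation and its OWN data `(z, shift, T)` and spend X₀ exactly once — the continuum clause is READ
OFF the lattice clause by the typed gap transfer of route `GradientFlowSpecies` (`GapTransfer`, stmt-8923:
uniform lattice gap + convergence of all lattice `n`-point functions ⇒ continuum gap, via Lüscher's positive
transfer matrix); the unpinned flavour-blind offset is removed by the LANDED `qcdOf_iff_threshold` (audit g7;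
the card's `ThresholdShift'` hypothesis is not needed — triage 1/3); `HasLatticeMassGap` never reads
`z, shift, T` (`hasLatticeMassGap_scheme_indep`, landed) and is monotone in the rate
(`hasLatticeMassGap_anti`, landed), so one `Δ/2` serves both clauses.  What is left is LATTICE-ONLY: for every
honest `reg`, above a `reg`-dependent mass threshold, lattice QCD at the scheme's own `(β_k, m_f(k))` is gapped
uniformly in the volume — and that residual is, BY NAME, the typed crux `GradientFlowSpecies.MassiveLatticeGap`
(stmt-8922; triage 3: the card's `HonestHeavyLatticeGap ↔ MassiveLatticeGap`, `TriageR1K3Checks.lean`).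

So the line has exactly TWO registered stubs, both stated BY NAME as the shared typed items they are
(a proof of either stub in `Theorems/` is verbatim a proof of that item, and conversely):

* `stub_gapTransfer      : GradientFlowSpecies.GapTransfer`      — the continuum-half ENGINE (size M–L; the
  line's own risk: three honest gaps listed in its docstring);
* `stub_massiveLatticeGap : GradientFlowSpecies.MassiveLatticeGap` — the lattice-half RESIDUAL (HARDEST; size
  open-problem: weak-coupling lattice Yang–Mills gap for all local observables uniformly in the volume +
  non-perturbative decoupling of honest heavy Wilson quarks).  This is where the MECHANISM lines of this crux
  (threshold-irrelevance-squeeze ≈ geometric-mean-handover, two-scale-lsi-handover, with low-mode-quarantine /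
  rao-blackwell-sign / proper-time as fermionic re-entry components) plug in: triage 1/2/3 all recommend this
  line as the COMMON HEAD of whichever mechanism is picked — `handover_of_gapTransfer_of_massiveLatticeGap`
  below is that head, with hypotheses by name, ready to be landed as a support theorem.

and the kernel-checked composition `RobustYangMillsHandover_of` (sorry-free; the two stubs are its only gaps).

§3 is sorry-free BOOKKEEPING offered to the lead as a RESHAPE OPTION (not registered): the residual may be
weakened to a SUBSEQUENTIAL form — `SubseqHonestLatticeGap`: for every honest `reg` some strictly increasing
`φ`, chosen BEFORE the threshold and the masses, along which the lattice gap holds — because the conclusion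
`QCD` re-quantifies `∃ reg` and every clause X₀ hands over (mass scaling, asymptotic scaling, physical branch,
convergence of the lattice `n`-point functions: `qcdLatticeSchwinger` reindexes along `φ` DEFINITIONALLY) is
stable under subsequences (`isQCDAlong_schemeSubseq`).  `handover_of_gapTransfer_of_subseq` proves
`GapTransfer → SubseqHonestLatticeGap → (ContinuumQCDExists → QCD)` and
`subseqHonestLatticeGap_of_massiveLatticeGap` proves `MassiveLatticeGap → SubseqHonestLatticeGap` (`φ = id`):
a lattice lever that only delivers a subsequence (cf. the subsequential conclusion of `RobustYangMills`
stmt-13897, barrier `UVStabilityNonUniqueness`) still closes this crux after a one-line reshape of stub 2.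

## Disproof.lean, honoured (cited by section)

* §1 `handover_iff_target_iff_qcd`, `not_handover_iff` (landed `Negative.not_handover_iff`): the line never
  touches the truth value of X₀; it proves the two gap clauses for X₀'s OWN witnesses (same-regularisation
  proof), so it is a proof of the crux, not of `QCD` outright.
* §2 `handoverWithoutNontriviality_iff_qcd` (landed `Negative.handover_withoutNontriviality_iff_qcd`) — THE
  load-bearing obstruction ("a proof must USE the non-triviality of the handed-over `T`"): honoured at
  `stub_massiveLatticeGap`, whose hypothesis IS the full X₀-body of `reg` INCLUDING the three non-triviality
  clauses (`IsNontrivial glue`, `IsNonGaussian glue`, `IsNontrivial (pseudoRe f g)`); they are what pins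
  `m_crit(k), Z_m(k)` honest (no cutoff-heavy cheat: the junk regularisation `canonicalAF` with `z = 0` of
  `continuumQCDExistsWithoutNontriviality_holds` is NOT in the hypothesis class restricted to non-trivial `T`).
  `stub_gapTransfer` does not need them and does not claim the crux without them (it is vacuum-true:
  `vacuum_hasMassGap'`, §3).
* §3 `vacuum_not_witness`: no stub uses the vacuum / `canonicalAF` as a witness.
* §4–§5 `handover_of_pointwise`, `handover_of_aboveThreshold`: the composition IS the above-threshold
  same-scheme handover, with the threshold AFTER the regularisation (`∀ reg ∃ M`, weaker than §5's
  `∃ M₀ ∀ reg`) — `qcdOf_iff_threshold` absorbs it.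
* §6 `sameReg_iff`, `hasLatticeMassGap_scheme_indep`, `latticeGapped_of_sameReg` (landed in
  `Negative/GapClauses.lean`; the two lemmas used here are restated verbatim in §0): the two clauses separate;
  stub 2 is literally §6's `SameRegLatticeGap` above a threshold, stub 1 discharges `SameRegContinuumGap` from it.
* §8 `continuumQCDExists_iff_threshold`: consistent (both sides speak above unpinned offsets).
* §9 (i) `quarkLoopShift_tendsto_atTop`, (ii) `scheme_mq_eventually_neg` (landed `Negative/SchemeAsymptotics`):
  this line makes NO `η(j*) → 0` and NO fine-operator coercivity claim; both corrections are constraints on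
  the PROVER of stub 2 (the honest bare trajectory is eventually NEGATIVE, `m_f(k) < −δ/2`; the marginal
  heavy-quark effect is an `O(log)` shift of `β`, so any YM-side input must be β-universal, 8796-type) and are
  repeated in its docstring.
* `-- Targets`: none at plan time (no line picked yet); no landed `Negative/` lemma refutes an instance of
  either stub (checked: `WithoutNontriviality`, `GapClauses`, `SchemeAsymptotics` are iff/asymptotics facts).
* Negatives index (`ledger negatives --problem QuantumFields`, 4 entries: 9665, 9603, 9494, 9599): none is an
  instance or a weakening of either stub (9599 refutes a misstated multiboson admissibility clause, 9494 a
  frame/conditioning claim of adaptive block fermions).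

Everything non-Mathlib in this file is referred to BY FULLY QUALIFIED NAME or opened explicitly; the two stubs
are the tree decls themselves, so each can land verbatim as `Theorems/<Name>.lean : GradientFlowSpecies.<Decl>`.
-/

noncomputable section

namespace Summit.QuantumFields.QCD.Cruxes.RobustYangMillsHandover.ExistencePaysTheContinuumHalf

open Summit.QuantumFields.QCD.Theses.HeatSlicedQuarks (ContinuumQCDExists RobustYangMillsHandover)
open Summit.QuantumFields.QCD.Theorems.GluonicCompletion.Negative (qcdOf_iff_threshold)
open Literature.MathematicalPhysics.QuantumFieldTheory
open Filter Topology

/-! ## §0 Two landed bookkeeping facts, restated (verbatim copies of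
`Theorems/RobustYangMillsHandover/Negative/GapClauses.lean`, `hasLatticeMassGap_scheme_indep` /
`hasLatticeMassGap_anti`, p73906 — copied rather than imported only because the farm snapshot that elaborates
Lines files may predate that module; provers should import the landed ones) -/

/-- The lattice gap clause does not see the species data `z, shift` (nor `T`): it reads only
`β_k, L_k, a_k, m_f(k)` of the scheme (landed: `Negative.hasLatticeMassGap_scheme_indep`). [folklore] -/
theorem hasLatticeMassGap_scheme_indep {Nf : ℕ} (reg : QCDRegularisation Nf) (m : Fin Nf → ℝ)
    (z shift z' shift' : QCDField Nf → ℕ → ℝ) (Δ : ℝ) :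
    (reg.scheme m z shift).HasLatticeMassGap Δ ↔ (reg.scheme m z' shift').HasLatticeMassGap Δ :=
  Iff.rfl

/-- `HasLatticeMassGap` is monotone: a lattice gap `Δ'` is a lattice gap `Δ ≤ Δ'` (landed:
`Negative.hasLatticeMassGap_anti`). [folklore] -/
theorem hasLatticeMassGap_anti {Nf : ℕ} (sch : QCDScheme Nf) {Δ Δ' : ℝ} (hle : Δ ≤ Δ')
    (h : sch.HasLatticeMassGap Δ') : sch.HasLatticeMassGap Δ := by
  intro R R' A B
  obtain ⟨C, hC⟩ := h R R' A B
  refine ⟨C, ?_⟩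
  filter_upwards [hC] with k hk S hS n hn
  refine (hk S hS n hn).trans ?_
  have hC0 : 0 ≤ C := by
    have h1 := (norm_nonneg _).trans (hk S hS n hn)
    exact nonneg_of_mul_nonneg_left h1 (Real.exp_pos _)
  refine mul_le_mul_of_nonneg_left (Real.exp_le_exp.mpr ?_) hC0
  have : 0 ≤ sch.a k * n := mul_nonneg (sch.a_pos k).le (Nat.cast_nonneg n)
  nlinarith

/-! ## §1 The two registered stubs (the only `sorry`s of the line) -/

/-- **stub_gapTransfer — the continuum-half ENGINE** = item `GradientFlowSpecies.GapTransfer`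
(stmt-QuantumFields-8923, support of route GradientFlowSpecies, typed, difficulty M there; M–L honestly) BY NAME:

  `∀ (Nf : ℕ) (sch : QCDScheme Nf) (T : OSData (QCDField Nf) 4) (Δ Δ' : ℝ), 0 < Δ' → Δ' < Δ →`
  `  IsQCDAlong sch T → sch.HasLatticeMassGap Δ → T.HasMassGap Δ'`

("uniform lattice gap + convergence of all lattice `n`-point functions ⇒ continuum gap at any smaller rate").
USED by the composition at `sch := reg.scheme m z shift` (X₀'s own scheme and data), `Δ' := Δ/2`.

Proof route (8923's docstring, Lüscher 1977 / Osterwalder–Seiler 1978 §§2–4 / Glimm–Jaffe Thm 6.1.3 /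
Seiler 1982 Ch. 3): FIX `k` large (so that `m_f(k) > −1`, the range of Lüscher positivity, from `IsQCDAlong`'s
physical-branch clause).  (a) Let the time extent `S → ∞` in `HasLatticeMassGap` (allowed: it is uniform in
`S ≥ L_k`) and read the pairwise bounds for ALL gauge-invariant local observables `A, B` SPECTRALLY through
the positive transfer matrix `𝕋_k`: the vectors `ÂΩ` span the physical space, each has spectral measure in
`{1} ∪ [0, e^{−a_kΔ}]`, hence the OPERATOR bound `‖𝕋_kⁿ − P_Ω‖ ≤ e^{−a_kΔn}` with constant `1`.  (b) Apply it
to time-ordered products of SMEARED species fields (arbitrary `k`-dependent coefficients `z_s(k) a_k⁴ f(a_k x)`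
are harmless for an operator-norm bound): `|S_k(ΘF̄ ⊗ T_t G) − S_k(ΘF̄) S_k(G)| ≤ e^{−Δ t}‖Ψ_F‖_k‖Ψ_G‖_k`
with `‖Ψ_F‖_k² = S_{k,2n}(ΘF̄ ⊗ F)` a reflection-positive lattice `2n`-point function.  (c) Pass `k → ∞` along
`IsQCDAlong` on real product tensors (the norms CONVERGE, hence are bounded); (d) extend from the algebraic
span of real off-diagonal product tensors to all time-ordered `F, G` by E0' continuity of both sides
(sesquilinear bound by Hilbert seminorms on a dense subspace).
THREE HONEST GAPS (triage 1 and 3; 8923's own docstring names the first two) — the stub worker must close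
them, they are where this stub can FAIL or grow: (G1) the finite-torus functional `qcdLatticeSchwinger` /
`qcdTorusExpect` is the `(−1)^F`-TWISTED TRACE on a time-periodic torus (tree `wilsonDirac` is time-periodic;
QCDOS docstring, audit g8 N2), not a state: the spectral reading applies to the `S → ∞` vacuum functional, and
`Tr[(−1)^F 𝕋^{2S+1} ⋯]/Tr[(−1)^F 𝕋^{2S+1}] →` vacuum expectation needs the vacuum to be the UNIQUE top
eigenvector of `𝕋_k` across bosonic AND fermionic sectors at fixed `k` (finite-dimensional at fixed `k, S`;
fermionic states gapped by the bare mass; but a proof is owed); (G2) ORDER OF LIMITS: (a)–(b) bound the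
`S → ∞` functional at fixed `k`, while `IsQCDAlong` converges at the scheme's OWN torus `S = L_k`; one needs
`|⟨·⟩_{k,L_k} − ⟨·⟩_{k,∞}| → 0` as `k → ∞` for smeared species products — wrap-around terms are
`O(e^{−Δ a_k L_k})`-small GIVEN the volume-uniform clustering of `HasLatticeMassGap` in the time direction and,
by the hypercubic symmetry of Wilson's actions, in every axis direction, with `a_k L_k → ∞`; (G3) NORM CONSTANTS:
`HasLatticeMassGap` gives per-pair constants `C(A,B)` with no uniformity over the `(2L_k+1)³` spatial
translates and the divergent `z_s(k)` entering a smeared insertion — only the OPERATOR form of (a) survives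
the smearing, so the proof must genuinely go through the transfer-matrix Hilbert space (an OS/Lüscher
reconstruction at fixed `k`), not through pairwise estimates; and (d) needs the constants as continuous
Hilbert seminorms (E0'), not bare `∃ C`.
Degenerate checks: vacuum-true (`OSData.vacuum_hasMassGap`), so not junk-refutable (Disproof §3); `z ≡ 0`
schemes give the vacuum.  Cheapest falsifier (card): the FREE heavy Wilson fermion on the time-periodic torus
(`β = ∞`, i.e. `U ≡ 1`), where both the twisted-trace functional and the transfer-matrix spectrum are
explicit — check (G1)–(G2) there first (kit, minutes).
Leans on: tree `IsQCDAlong`, `qcdLatticeSchwinger`, `QCDScheme.HasLatticeMassGap`, `OSData.HasMassGap`,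
`LabelledSchwingerFamily.HasMassGap`, `OSData.linearGrowth` (E0'), `OSData.reflectionPositive` (E2);
Literature `Luscher1977` (positive transfer matrix for Wilson fermions, `κ < 1/6`), `OsterwalderSeiler1978`
§§2–4, `GlimmJaffe1987` Thm 6.1.3, `Seiler1982` Ch. 3; Mathlib spectral theorem for self-adjoint operators
on finite-dimensional spaces suffices at fixed `(k, S)`.  Size: M–L (one lineage; no missing definitions, but
the fixed-`k` transfer-matrix reconstruction for the tree's Grassmann/Wilson conventions is unbuilt).
Closes when item 8923 closes (same decl), and a proof filed for this stub closes 8923. -/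
theorem stub_gapTransfer : Summit.QuantumFields.QCD.Theses.GradientFlowSpecies.GapTransfer := by
  sorry

/-- **stub_massiveLatticeGap — the lattice-half RESIDUAL (HARDEST stub)** = item
`GradientFlowSpecies.MassiveLatticeGap` (stmt-QuantumFields-8922, crux rank 4 of route GradientFlowSpecies,
typed, difficulty open-problem) BY NAME; it is the card's `C⁺ = HonestHeavyLatticeGap` up to `Iff`
(triage 3, `TriageR1K3Checks.honestHeavyLatticeGap_iff_massiveLatticeGap`) and Disproof §6's
`SameRegLatticeGap` above a `reg`-dependent threshold (triage 1/2):

  `∀ Nf : ℕ, Nf = 2 ∨ Nf = 3 → ∀ reg : QCDRegularisation Nf,`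
  `  (reg.HasMassScaling ∧ ∀ m, (∀ f, 0 < m f) → ∃ z shift T, IsQCDAlong (reg.scheme m z shift) T ∧`
  `     T.IsNontrivial glue ∧ T.IsNonGaussian glue ∧ ∀ f g, f ≠ g → T.IsNontrivial (pseudoRe f g)) →`
  `  ∃ M : ℝ, ∀ m, (∀ f, M < m f) → ∃ Δ : ℝ, 0 < Δ ∧ (reg.scheme m 0 0).HasLatticeMassGap Δ`

i.e. for EVERY X₀-honest regularisation (hypothesis = the `∃ reg`-body of `ContinuumQCDExists` for this
`reg`, INCLUDING the three non-triviality clauses — this is where Disproof §2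
`handoverWithoutNontriviality_iff_qcd` is honoured: drop them and `canonicalAF` with cutoff-decoupled quarks
enters the class, where the conclusion degenerates to the pure-gauge lattice gap along `β_k`), above SOME mass
threshold `M = M(reg)`, lattice QCD at the scheme's own couplings `β_k` and HONEST bare masses
`m_crit(k) + a_k m_f/Z_m(k)` has a volume-uniform full-spectrum lattice gap `Δ(m) > 0` (all gauge-invariant
local lattice QCD observables; `z, shift` irrelevant by `hasLatticeMassGap_scheme_indep`).
CONTENT = weak-coupling lattice SU(3) Yang–Mills gap for all local observables uniformly in the volume
(barrier `PerturbativeInvisibility`: no expansion in `g` sees it) + NON-PERTURBATIVE decoupling of heavy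
PHYSICAL quarks: honesty forces `a_k m_f/Z_m(k) → 0`, `κ → κ_c(β_k)` — beyond the hopping expansion (barrier
`HoppingExpansionUniformGap`), and by `Negative.SchemeAsymptotics.scheme_mq_eventually_neg` (Disproof §9(ii))
the bare trajectory is eventually NEGATIVE whenever `m_crit(k) ≤ −δ` eventually, so no accretivity of the fine
Wilson–Dirac operator is available: coercivity can only be a BLOCK-scale property; the marginal heavy-quark
effect is the divergent coupling shift `2(b₀(0) − b₀(N_f)) log(1/(a²M²))` (§9(i),
`quarkLoopShift_tendsto_atTop`), so any Yang–Mills input must be β-UNIVERSAL along matched a.f. sequences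
(`HeavyThresholdYMBridge.YMLatticeGapAlongAFSequences`, stmt-8796, or stronger: the mechanism cards' MixingYM /
YC+CG / TwoScaleData are all complete-analyticity-strength ≥ 8796 — triage cross-cutting note 2).
Why it might fail (8922's docstring + triage): contains the YM lattice mass gap; an honest calibration parked
for infinitely many `k` in an exotic Wilson phase (Aoki / negative-mass side, Sharpe–Singleton 1998) must be
absorbed by the threshold (it can: `M` is existential per `reg`, finger widths `≪ a_k M/Z_m` eventually —
triage 2); `N_f = 3` and split `N_f = 2` masses make the measure SIGNED (barriers `WilsonDeterminantSign`,
`WilsonDeterminantMassSplitting`; card rao-blackwell-sign is the one sign lever on file).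
The quantifier shape is the WEAKEST the crux allows at full-sequence level (threshold after `reg`, rate per
`m`, lattice clause only); §3 below weakens it further to a subsequence (reshape option).
Leans on (for its provers, not for this file): the mechanism lines' stubs; `qcdOf_iff_threshold`;
`DiagonalSpine.SubsequenceStability`-type bookkeeping (§3 here).  Sources: JaffeWitten2000 §5,
OsterwalderSeiler1978, Seiler1982 Ch. 3, SharpeSingleton1998, AppelquistCarazzone1975, BrunoEtAl2015HeavySea,
Balaban1989LargeFieldII.  Closes when item 8922 closes (same decl), and a proof filed here closes 8922. -/
theorem stub_massiveLatticeGap : Summit.QuantumFields.QCD.Theses.GradientFlowSpecies.MassiveLatticeGap := by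
  sorry

/-! ## §2 The composition (sorry-free): the two stubs ⇒ the crux BY NAME -/

/-- **The common head of every line on this crux** (hypotheses BY NAME, landable verbatim as a support
theorem): `GapTransfer (8923) → MassiveLatticeGap (8922) → (ContinuumQCDExists → QCD)`.
Logic: fix `N_f ∈ {2,3}`; X₀ gives `reg` with `HasMassScaling` and the honest body `hb`; stub 2 at `(reg, hb)`
gives the threshold `M`; by the landed `qcdOf_iff_threshold` it suffices to produce the `QCDOf`-body above
`M₀ := max M 0` for THIS `reg`; for such `m`, X₀ supplies `(z, shift, T)` (non-triviality clauses passed on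
verbatim), stub 2 supplies `Δ > 0` with the lattice gap of `reg.scheme m 0 0`, transported to
`reg.scheme m z shift` by `hasLatticeMassGap_scheme_indep` (`Iff.rfl`); stub 1 turns it into
`T.HasMassGap (Δ/2)`; `hasLatticeMassGap_anti` puts the lattice clause at `Δ/2` too. (Re-derivation of
triage 1's `Card1Check` / triage 3's `handover_of_gapTransfer_of_massiveLatticeGap`, over the landed
`qcdOf_iff_threshold` and the §0 copies of the landed gap-clause lemmas.) -/
theorem handover_of_gapTransfer_of_massiveLatticeGap
    (hGT : Summit.QuantumFields.QCD.Theses.GradientFlowSpecies.GapTransfer)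
    (hML : Summit.QuantumFields.QCD.Theses.GradientFlowSpecies.MassiveLatticeGap) :
    ContinuumQCDExists → _root_.QCD := by
  intro hX
  have key : ∀ Nf : ℕ, (Nf = 2 ∨ Nf = 3) → QCDOf Nf := by
    intro Nf hNf
    obtain ⟨reg, hms, hb⟩ := hX Nf hNf
    obtain ⟨M, hM⟩ := hML Nf hNf reg ⟨hms, hb⟩
    refine (qcdOf_iff_threshold Nf).mpr ⟨max M 0, le_max_right _ _, reg, hms, fun m hm => ?_⟩
    have hm0 : ∀ f, 0 < m f := fun f => lt_of_le_of_lt (le_max_right M 0) (hm f)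
    have hmM : ∀ f, M < m f := fun f => lt_of_le_of_lt (le_max_left M 0) (hm f)
    obtain ⟨z, shift, T, hA, hN, hG, hP⟩ := hb m hm0
    obtain ⟨Δ, hΔ, hL⟩ := hM m hmM
    have hL' : (reg.scheme m z shift).HasLatticeMassGap Δ :=
      (hasLatticeMassGap_scheme_indep reg m 0 0 z shift Δ).mp hL
    refine ⟨z, shift, T, hA, hN, hG, hP, Δ / 2, half_pos hΔ, ?_, ?_⟩
    · exact hGT Nf (reg.scheme m z shift) T Δ (Δ / 2) (half_pos hΔ) (half_lt_self hΔ) hA hL'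
    · exact hasLatticeMassGap_anti _ (half_le_self hΔ.le) hL'
  exact ⟨key 2 (Or.inl rfl), key 3 (Or.inr rfl)⟩

/-- **RobustYangMillsHandover_of — the line closes the crux modulo exactly the two registered stubs.**
(`RobustYangMillsHandover` unfolds to `ContinuumQCDExists → QCD`; the conclusion is the route decl BY NAME.) -/
theorem RobustYangMillsHandover_of :
    Summit.QuantumFields.QCD.Theses.HeatSlicedQuarks.RobustYangMillsHandover :=
  handover_of_gapTransfer_of_massiveLatticeGap stub_gapTransfer stub_massiveLatticeGap

/-! ## §3 Bookkeeping (sorry-free, NOT registered): the subsequential residual — a reshape option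

Everything X₀ hands over about its regularisation is a tail / limit statement in `k`, and the lattice
`n`-point functions reindex along a subsequence ON THE NOSE, so the honest body passes to `reg ∘ φ` for every
strictly increasing `φ`.  Hence the lattice lever may deliver its gap only along SOME subsequence chosen per
`reg` (before the threshold and the masses): `SubseqHonestLatticeGap`.  It is implied by stub 2 (`φ = id`) and
still closes the crux with stub 1.  If the lead's lattice lever is subsequential, replace stub 2 by
`theorem stub_subseqHonestLatticeGap : SubseqHonestLatticeGap := …` and `RobustYangMillsHandover_of` by
`handover_of_gapTransfer_of_subseq stub_gapTransfer stub_subseqHonestLatticeGap` (re-run `skeleton check`). -/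

section Subsequences

variable {Nf : ℕ}

/-- The subsequence `sch ∘ φ` of a scheme: every datum precomposed with `φ` (`a ∘ φ → 0`, `(aL) ∘ φ → ∞`
by `StrictMono.tendsto_atTop`). [folklore] -/
def schemeSubseq (sch : QCDScheme Nf) (φ : ℕ → ℕ) (hφ : StrictMono φ) : QCDScheme Nf where
  a := fun k => sch.a (φ k)
  a_pos := fun k => sch.a_pos (φ k)
  tendsto_a := sch.tendsto_a.comp hφ.tendsto_atTop
  β := fun k => sch.β (φ k)
  L := fun k => sch.L (φ k)
  tendsto_L := sch.tendsto_L.comp hφ.tendsto_atTop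
  mq := fun f k => sch.mq f (φ k)
  z := fun s k => sch.z s (φ k)
  shift := fun s k => sch.shift s (φ k)

/-- The subsequence `reg ∘ φ` of a regularisation (`m_crit`, `Z_m` precomposed too). [folklore] -/
def regSubseq (reg : QCDRegularisation Nf) (φ : ℕ → ℕ) (hφ : StrictMono φ) : QCDRegularisation Nf where
  a := fun k => reg.a (φ k)
  a_pos := fun k => reg.a_pos (φ k)
  tendsto_a := reg.tendsto_a.comp hφ.tendsto_atTop
  β := fun k => reg.β (φ k)
  L := fun k => reg.L (φ k)
  tendsto_L := reg.tendsto_L.comp hφ.tendsto_atTop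
  mcrit := fun k => reg.mcrit (φ k)
  Zm := fun k => reg.Zm (φ k)
  Zm_pos := fun k => reg.Zm_pos (φ k)

/-- The scheme of `reg ∘ φ` at masses `m` and reindexed species data is the subsequence of the scheme of
`reg` (DEFINITIONAL: the bare trajectory `m_crit(φ k) + a_{φ k} m_f / Z_m(φ k)` reindexes on the nose). [folklore] -/
theorem regSubseq_scheme (reg : QCDRegularisation Nf) (φ : ℕ → ℕ) (hφ : StrictMono φ)
    (m : Fin Nf → ℝ) (z shift : QCDField Nf → ℕ → ℝ) :
    (regSubseq reg φ hφ).scheme m (fun s k => z s (φ k)) (fun s k => shift s (φ k)) =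
      schemeSubseq (reg.scheme m z shift) φ hφ := rfl

/-- With `φ = id` nothing changes (structure eta). [folklore] -/
theorem regSubseq_id_scheme (reg : QCDRegularisation Nf) (m : Fin Nf → ℝ)
    (z shift : QCDField Nf → ℕ → ℝ) :
    (regSubseq reg id strictMono_id).scheme m z shift = reg.scheme m z shift := rfl

/-- Lattice `n`-point functions reindex along subsequences (DEFINITIONAL: `qcdLatticeSchwinger sch k` reads
only the `k`-th data of `sch`). [folklore] -/
theorem qcdLatticeSchwinger_schemeSubseq (sch : QCDScheme Nf) (φ : ℕ → ℕ) (hφ : StrictMono φ)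
    (k n : ℕ) (σ : Fin n → QCDField Nf) (f : Fin n → SchwartzMap (EuclideanSpace ℝ (Fin 4)) ℝ) :
    qcdLatticeSchwinger (schemeSubseq sch φ hφ) k n σ f = qcdLatticeSchwinger sch (φ k) n σ f := rfl

/-- `IsQCDAlong` passes to subsequences: asymptotic scaling and the physical-branch clause are tail
statements, and the convergence of the lattice `n`-point functions is a `Tendsto` along `k`. [folklore] -/
theorem isQCDAlong_schemeSubseq {sch : QCDScheme Nf} {T : OSData (QCDField Nf) 4}
    (h : IsQCDAlong sch T) (φ : ℕ → ℕ) (hφ : StrictMono φ) : IsQCDAlong (schemeSubseq sch φ hφ) T := by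
  obtain ⟨⟨Λ, hΛ, hβ⟩, hbranch, hconv⟩ := h
  refine ⟨⟨Λ, hΛ, hβ.comp hφ.tendsto_atTop⟩, fun fl => hφ.tendsto_atTop.eventually (hbranch fl),
    fun n hn σ f F hF hoff => ?_⟩
  exact ((hconv n hn σ f F hF hoff).comp hφ.tendsto_atTop).congr
    fun k => (qcdLatticeSchwinger_schemeSubseq sch φ hφ k n σ f).symm

/-- `HasMassScaling` passes to subsequences. [folklore] -/
theorem hasMassScaling_regSubseq {reg : QCDRegularisation Nf} (h : reg.HasMassScaling)
    (φ : ℕ → ℕ) (hφ : StrictMono φ) : (regSubseq reg φ hφ).HasMassScaling := by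
  obtain ⟨c, hc, ht⟩ := h
  exact ⟨c, hc, ht.comp hφ.tendsto_atTop⟩

/-- `HasLatticeMassGap` passes to subsequences (not needed by the composition; recorded for provers who
reshape). [folklore] -/
theorem hasLatticeMassGap_schemeSubseq {sch : QCDScheme Nf} {Δ : ℝ} (h : sch.HasLatticeMassGap Δ)
    (φ : ℕ → ℕ) (hφ : StrictMono φ) : (schemeSubseq sch φ hφ).HasLatticeMassGap Δ := by
  intro R R' A B
  obtain ⟨C, hC⟩ := h R R' A B
  exact ⟨C, hφ.tendsto_atTop.eventually hC⟩

/-- The honest body of X₀ for one regularisation (the `∃ reg`-body of `ContinuumQCDExists`; Disproof §6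
`IsTargetReg`; hypothesis of `MassiveLatticeGap`). -/
def IsHonest (reg : QCDRegularisation Nf) : Prop :=
  reg.HasMassScaling ∧ ∀ m : Fin Nf → ℝ, (∀ f, 0 < m f) →
    ∃ (z shift : QCDField Nf → ℕ → ℝ) (T : OSData (QCDField Nf) 4),
      IsQCDAlong (reg.scheme m z shift) T ∧ T.IsNontrivial QCDField.glue ∧
        T.IsNonGaussian QCDField.glue ∧ ∀ f g : Fin Nf, f ≠ g → T.IsNontrivial (QCDField.pseudoRe f g)

/-- **Honesty is subsequence-stable**, with the SAME OS data `T` at every mass tuple (reindex `z, shift`).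
[folklore] -/
theorem isHonest_regSubseq {reg : QCDRegularisation Nf} (h : IsHonest reg) (φ : ℕ → ℕ)
    (hφ : StrictMono φ) : IsHonest (regSubseq reg φ hφ) := by
  obtain ⟨hms, hb⟩ := h
  refine ⟨hasMassScaling_regSubseq hms φ hφ, fun m hm => ?_⟩
  obtain ⟨z, shift, T, hA, hN, hG, hP⟩ := hb m hm
  refine ⟨fun s k => z s (φ k), fun s k => shift s (φ k), T, ?_, hN, hG, hP⟩
  rw [regSubseq_scheme]
  exact isQCDAlong_schemeSubseq hA φ hφ

end Subsequences

/-- **The SUBSEQUENTIAL residual** (weakest form of the lattice half this crux can use; NOT registered —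
reshape option): for `N_f = 2, 3` and every honest `reg`, SOME strictly increasing `φ` (chosen before the
threshold and the masses — one `φ` must serve every mass tuple, since `QCDOf` wants ONE regularisation) and
some threshold `M` such that along `reg ∘ φ` every mass tuple above `M` has a volume-uniform lattice gap. -/
def SubseqHonestLatticeGap : Prop :=
  ∀ Nf : ℕ, Nf = 2 ∨ Nf = 3 → ∀ reg : QCDRegularisation Nf, IsHonest reg →
    ∃ (φ : ℕ → ℕ) (hφ : StrictMono φ) (M : ℝ), ∀ m : Fin Nf → ℝ, (∀ f, M < m f) →
      ∃ Δ : ℝ, 0 < Δ ∧ ((regSubseq reg φ hφ).scheme m 0 0).HasLatticeMassGap Δ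

/-- Stub 2 implies the subsequential residual (`φ = id`, structure eta). [folklore] -/
theorem subseqHonestLatticeGap_of_massiveLatticeGap
    (hML : Summit.QuantumFields.QCD.Theses.GradientFlowSpecies.MassiveLatticeGap) :
    SubseqHonestLatticeGap := by
  intro Nf hNf reg hreg
  obtain ⟨M, hM⟩ := hML Nf hNf reg hreg
  refine ⟨id, strictMono_id, M, fun m hm => ?_⟩
  obtain ⟨Δ, hΔ, hL⟩ := hM m hm
  rw [regSubseq_id_scheme]
  exact ⟨Δ, hΔ, hL⟩

/-- **The subsequential residual still closes the crux** (with stub 1): pass from X₀'s `reg` to `reg ∘ φ`,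
which is again honest with the same `T`'s (`isHonest_regSubseq`), and run §2's logic there.  Conclusion
stated as the UNFOLDED crux `ContinuumQCDExists → QCD` (so that this optional theorem is not mistaken for the
skeleton theorem by the audit; `RobustYangMillsHandover` is this arrow by `rfl`). [folklore] -/
theorem handover_of_gapTransfer_of_subseq
    (hGT : Summit.QuantumFields.QCD.Theses.GradientFlowSpecies.GapTransfer)
    (hS : SubseqHonestLatticeGap) : ContinuumQCDExists → _root_.QCD := by
  intro hX
  have key : ∀ Nf : ℕ, (Nf = 2 ∨ Nf = 3) → QCDOf Nf := by
    intro Nf hNf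
    obtain ⟨reg, hreg⟩ := hX Nf hNf
    obtain ⟨φ, hφ, M, hM⟩ := hS Nf hNf reg hreg
    obtain ⟨hms', hb'⟩ := isHonest_regSubseq (reg := reg) hreg φ hφ
    refine (qcdOf_iff_threshold Nf).mpr
      ⟨max M 0, le_max_right _ _, regSubseq reg φ hφ, hms', fun m hm => ?_⟩
    have hm0 : ∀ f, 0 < m f := fun f => lt_of_le_of_lt (le_max_right M 0) (hm f)
    have hmM : ∀ f, M < m f := fun f => lt_of_le_of_lt (le_max_left M 0) (hm f)
    obtain ⟨z, shift, T, hA, hN, hG, hP⟩ := hb' m hm0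
    obtain ⟨Δ, hΔ, hL⟩ := hM m hmM
    have hL' : ((regSubseq reg φ hφ).scheme m z shift).HasLatticeMassGap Δ :=
      (hasLatticeMassGap_scheme_indep (regSubseq reg φ hφ) m 0 0 z shift Δ).mp hL
    refine ⟨z, shift, T, hA, hN, hG, hP, Δ / 2, half_pos hΔ, ?_, ?_⟩
    · exact hGT Nf _ T Δ (Δ / 2) (half_pos hΔ) (half_lt_self hΔ) hA hL'
    · exact hasLatticeMassGap_anti _ (half_le_self hΔ.le) hL'
  exact ⟨key 2 (Or.inl rfl), key 3 (Or.inr rfl)⟩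

/-- Sanity link: the crux IS the arrow the two optional compositions conclude. [folklore] -/
theorem robustYangMillsHandover_iff :
    Summit.QuantumFields.QCD.Theses.HeatSlicedQuarks.RobustYangMillsHandover ↔
      (ContinuumQCDExists → _root_.QCD) :=
  Iff.rfl

end Summit.QuantumFields.QCD.Cruxes.RobustYangMillsHandover.ExistencePaysTheContinuumHalf

end
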